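import Literature.AnabelianGeometry.EtaleTheta.SettingModelChiTwist
import Literature.AnabelianGeometry.SemiGraphs.TemperedFibreProductCompletion
import HarnessLib

/-!
# A model of the [EtTh] §1 root, reshape (B) STAGE 2 («Tate shear»), part F2b: the shear
# `a ↦ a·b^k, b ↦ b` of `F̂₂` (`k ∈ Ẑ`) and the affine action of `Ẑ ⋊ Ẑ^×`

Mochizuki, *The étale theta function …*, Publ. RIMS **45** (2009) [EtTh], §1, PRIMS PDF pp. 12–13
[cite: MochizukiEtTh2009, §1 p.13]: "`(Δ^tp_Y)^ell ≅ Ẑ(1)`", "`1 → (Δ^tp_Y)^ell ⊗ ℤ/Nℤ → Gal(Y_N/Y) →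
Gal(K_N/K) → 1`", "`K_N := K(ζ_N, q_X^{1/N})`", "`G_{K_N}` acts trivially on `(Δ^tp_X)^ell/N·(Δ^tp_Y)^ell`"
— i.e. `G_K` acts on `(Δ^tp_X)^ell ≅ Ẑ·a ⊕ Ẑ(1)·b` through the AFFINE group `Ẑ(1) ⋊ Ẑ^×` by
`σ ↦ (κ_q(σ), χ(σ))` (cyclotomic character AND the Kummer cocycle of `q_X` — the Galois module of the
`N`-torsion of the Tate curve, `σ·P₂ = P₂ + κ(σ)P₁`). Layer L2 of the abc-iut cell, seat abc-iut-L2-t6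
(gen 5): file **F2b** of the R78 cluster (abc-iut-L6-d6's R78-MAP #2, item (2): design note F-t6g5-2
«Tate twist» ADOPTED as STAGE 2), built OVER abc-iut-w5-d024's F2 `SettingModelChiTwist.lean` (`bPow`,
`twist`, `twistHom`, `ext_of_eta`, `eHat_twist`, `hHat_twist`) and abc-iut-L2-t1's root-model chain
(`F₂hatT`, `eta`, `eHat`, `hHat`, `Gfp`, …) — consumed BY NAME, nothing restated or edited.

WHY (abc-iut-L6-d6 / this seat): with the DIAGONAL twist `θ_u : a ↦ a, b ↦ b^u` alone the Galois action on
`(Δ^tp_X)^ell` is SPLIT, so `IsTateOrigin.tate N` (N ≥ 3), `IsThm16Origin.tate2`, `GKNIsKernelOfAction N`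
and the `κ(q̈)`-term of Prop. 1.5 (iii) fail at the χ-twisted model exactly as at the root model; the
affine action `θ_{u,k} : a ↦ a·b^k, b ↦ b^u`, `(k, u) = (κ_q σ, χ σ)`, repairs them. THIS FILE (pure
profinite group theory, no Galois theory):
* `shearEnd k` / `shear k : F̂₂ ≃ₜ* F̂₂` — the continuous extension of `a ↦ η a · b^k`, `b ↦ η b`
  (`k ∈ Ẑ`, written multiplicatively as the tree's `ZH`); `shear_one`, `shear_mul` (`k ↦ shear k` is a
  homomorphism `Ẑ → Aut(F̂₂)`: `shearHom`), `shear_bPow` (the shear fixes `b^Ẑ`);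
* `twist_shear : θ_α (shear k x) = shear (α k) (θ_α x)` — the semidirect relation; hence the **affine
  action** `affTwist : Ẑ ⋊ Ẑ^× →* Aut(F̂₂)`, `⟨k, α⟩ ↦ shear k ∘ θ_α` (`(k,α)(k',α') = (k·α k', αα')`);
* `eHat_shear` — the shear fixes the completed `a`-exponent, hence preserves `Γ = F̂₂ ×_Ẑ ℤ`
  (`affTwistGfp : Ẑ ⋊ Ẑ^× →* Aut(Γ)`, `gfpFst_affTwistGfp`, `gfpSnd_affTwistGfp`, `affTwistGfp_inr`,
  `continuous_affTwistGfp`);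
* the Heisenberg levels: **`hHat_shear_of_level_eq_one`** (`k ∈ N·Ẑ ⇒ ĥ_N ∘ shear k = ĥ_N`) and
  **`hHat_shear_of_eHat_eq_one`** (`ê x = 1 ⇒ ĥ_N (shear k x) = ĥ_N x`: on `Ker ê = Δ̂_Y` every shear is
  level-trivial — proved on the dense `η(Ker expA)` through the rational Heisenberg shear
  `(x,y,z) ↦ (x, y + Kx, z + K(x²+x)/2)`, then by fibrewise density, abc-iut-w5-d218's
  `TemperedFibreProduct.exists_inv_mul_eta_mem_and_apply_eq`). CAUTION (abc-iut-L6-d6): for `k ∉ N·Ẑ` the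
  shear does NOT descend to `Heis(ℤ/N)` when `N` is even (`(x²+x)/2 mod N` is not a function of `x mod N`),
  so no `diagTwist`-style global formula is stated; the two laws above are what the covering tower needs
  (`Y_N`, `Z_N` live inside `Ker ê`), and `hHat_affTwist_of_level` packages them for F4's «level-wise
  locally trivial» hypothesis.
SEMI-SYNTHETIC MODEL, CONSISTENCY EVIDENCE ONLY — not the tempered fundamental group of a curve; post-freeze
class (b) CONSTRUCTION over the frozen interface (no interface clause touched). Nothing of [EtTh] is
asserted; no side is taken on [IUTchIII] Cor. 3.12.
-/

noncomputable section

namespace Literature.AnabelianGeometry.EtaleTheta.SettingModel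

open Literature.AnabelianGeometry.SemiGraphs
open Literature.AnabelianGeometry.AbsoluteAnabelian
open CategoryTheory Function ProfiniteGrp ProfiniteGrp.ProfiniteCompletion

/-! ### The shear endomorphisms `a ↦ a·b^k, b ↦ b` -/

/-- The images of the free generators under the shear: `a ↦ η a · b^k`, `b ↦ η b`. [cite: MochizukiEtTh2009, §1 p.13] -/
def shearGen (k : ZH) : Fin 2 → F₂hatT := ![eta (FreeGroup.of 0) * bPow k, eta (FreeGroup.of 1)]

/-- **The shear `F̂₂ → F̂₂`**, the continuous extension of `a ↦ η a · b^k, b ↦ η b` (`k ∈ Ẑ`).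
[cite: MochizukiEtTh2009, §1 p.13] -/
def shearEnd (k : ZH) : F₂hatT →ₜ* F₂hatT :=
  (ProfiniteGrp.ProfiniteCompletion.lift (P := F₂hat) (GrpCat.ofHom (FreeGroup.lift (shearGen k)))).hom

/-- The shear on `η(F₂)`. [cite: MochizukiEtTh2009, §1 p.13] -/
theorem shearEnd_eta (k : ZH) (g : F₂) : shearEnd k (eta g) = FreeGroup.lift (shearGen k) g :=
  lift_hom_toCompletion F₂hat (FreeGroup.lift (shearGen k)) g

/-- `shear k (η a) = η a · b^k`. [cite: MochizukiEtTh2009, §1 p.13] -/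
theorem shearEnd_eta_of_zero (k : ZH) :
    shearEnd k (eta (FreeGroup.of 0)) = eta (FreeGroup.of 0) * bPow k := by
  rw [shearEnd_eta, FreeGroup.lift_apply_of]; rfl

/-- `shear k (η b) = η b`. [cite: MochizukiEtTh2009, §1 p.13] -/
theorem shearEnd_eta_of_one (k : ZH) : shearEnd k (eta (FreeGroup.of 1)) = eta (FreeGroup.of 1) := by
  rw [shearEnd_eta, FreeGroup.lift_apply_of]; rfl

/-- **The shear fixes `b^Ẑ`**: `shear k (b^t) = b^t` (two continuous homomorphisms `Ẑ → F̂₂` agreeing on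
`η(1)`). [cite: MochizukiEtTh2009, §1 p.13] -/
theorem shearEnd_bPow (k t : ZH) : shearEnd k (bPow t) = bPow t := by
  have h := ZHatCompletion.monoidHom_ext_of_continuous
    (f₁ := (shearEnd k).toMonoidHom.comp bPow.toMonoidHom) (f₂ := bPow.toMonoidHom)
    ((shearEnd k).continuous.comp bPow.continuous) bPow.continuous (by
      change shearEnd k (bPow (iotaZ (Multiplicative.ofAdd 1))) = bPow (iotaZ (Multiplicative.ofAdd 1))
      rw [bPow_iotaZ_one, shearEnd_eta_of_one])
  exact DFunLike.congr_fun h t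

/-- `shear 1 = id` (`b^1 = 1` for the multiplicatively written `1 ∈ Ẑ`, i.e. the zero shear).
[cite: MochizukiEtTh2009, §1 p.13] -/
theorem shearEnd_one : shearEnd 1 = ContinuousMonoidHom.id F₂hatT := by
  refine ext_of_eta ?_ ?_
  · rw [shearEnd_eta_of_zero, map_one, mul_one]; rfl
  · rw [shearEnd_eta_of_one]; rfl

/-- **Composition law** `shear (k·k') = shear k ∘ shear k'` (`a ↦ a·b^{k'} ↦ a·b^k·b^{k'}`).
[cite: MochizukiEtTh2009, §1 p.13] -/
theorem shearEnd_mul (k k' : ZH) : shearEnd (k * k') = (shearEnd k).comp (shearEnd k') := by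
  refine ext_of_eta ?_ ?_
  · change shearEnd (k * k') (eta (FreeGroup.of 0)) = shearEnd k (shearEnd k' (eta (FreeGroup.of 0)))
    rw [shearEnd_eta_of_zero, shearEnd_eta_of_zero, map_mul (shearEnd k), shearEnd_eta_of_zero,
      shearEnd_bPow, map_mul bPow, mul_assoc]
  · change shearEnd (k * k') (eta (FreeGroup.of 1)) = shearEnd k (shearEnd k' (eta (FreeGroup.of 1)))
    rw [shearEnd_eta_of_one, shearEnd_eta_of_one, shearEnd_eta_of_one]

/-! ### The shear as automorphisms, the homomorphism `Ẑ → Aut(F̂₂)` -/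

/-- **`shear k : F̂₂ ≃ₜ* F̂₂`** (inverse `shear k⁻¹`). [cite: MochizukiEtTh2009, §1 p.13] -/
def shear (k : ZH) : F₂hatT ≃ₜ* F₂hatT where
  toFun := shearEnd k
  invFun := shearEnd k⁻¹
  left_inv x := by
    change (shearEnd k⁻¹).comp (shearEnd k) x = x
    rw [← shearEnd_mul, inv_mul_cancel, shearEnd_one]; rfl
  right_inv x := by
    change (shearEnd k).comp (shearEnd k⁻¹) x = x
    rw [← shearEnd_mul, mul_inv_cancel, shearEnd_one]; rfl
  map_mul' := map_mul _
  continuous_toFun := (shearEnd _).continuous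
  continuous_invFun := (shearEnd _).continuous

/-- `shear k x = shearEnd k x`. [cite: MochizukiEtTh2009, §1 p.13] -/
theorem shear_apply (k : ZH) (x : F₂hatT) : shear k x = shearEnd k x := rfl

/-- `shear k (η a) = η a · b^k`. [cite: MochizukiEtTh2009, §1 p.13] -/
theorem shear_eta_of_zero (k : ZH) : shear k (eta (FreeGroup.of 0)) = eta (FreeGroup.of 0) * bPow k :=
  shearEnd_eta_of_zero k

/-- `shear k (b^t) = b^t`. [cite: MochizukiEtTh2009, §1 p.13] -/
theorem shear_bPow (k t : ZH) : shear k (bPow t) = bPow t := shearEnd_bPow k t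

/-- `shear 1 = id` on elements. [cite: MochizukiEtTh2009, §1 p.13] -/
theorem shear_one (x : F₂hatT) : shear 1 x = x := by
  rw [shear_apply, shearEnd_one]; rfl

/-- `shear (k·k') = shear k ∘ shear k'` on elements. [cite: MochizukiEtTh2009, §1 p.13] -/
theorem shear_mul (k k' : ZH) (x : F₂hatT) : shear (k * k') x = shear k (shear k' x) := by
  rw [shear_apply, shearEnd_mul]; rfl

/-- **`Ẑ → Aut(F̂₂)`**, `k ↦ shear k`, a homomorphism of groups. [cite: MochizukiEtTh2009, §1 p.13] -/
def shearHom : ZH →* MulAut F₂hatT where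
  toFun k := (shear k).toMulEquiv
  map_one' := MulEquiv.ext fun x => shear_one x
  map_mul' k k' := MulEquiv.ext fun x => shear_mul k k' x

/-! ### The semidirect relation with the twist, and the affine action -/

/-- **`θ_α ∘ shear k = shear (α k) ∘ θ_α`** (`θ_α (a·b^k) = a·b^{α k}`). [cite: MochizukiEtTh2009, §1 p.13] -/
theorem twist_shear (α : MulAut ZH) (k : ZH) (x : F₂hatT) :
    twist α (shear k x) = shear (α k) (twist α x) := by
  have h : (twistEnd (α (iotaZ (Multiplicative.ofAdd 1)))).comp (shearEnd k) =
      (shearEnd (α k)).comp (twistEnd (α (iotaZ (Multiplicative.ofAdd 1)))) := by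
    refine ext_of_eta ?_ ?_
    · change twistEnd _ (shearEnd k (eta (FreeGroup.of 0))) = shearEnd _ (twistEnd _ (eta (FreeGroup.of 0)))
      rw [shearEnd_eta_of_zero, map_mul, twistEnd_eta_of_zero, twistEnd_bPow, shearEnd_eta_of_zero]
    · change twistEnd _ (shearEnd k (eta (FreeGroup.of 1))) = shearEnd _ (twistEnd _ (eta (FreeGroup.of 1)))
      rw [shearEnd_eta_of_one, twistEnd_eta_of_one, shearEnd_bPow]
  exact DFunLike.congr_fun h x

/-- **The affine action `Ẑ ⋊ Ẑ^× → Aut(F̂₂)`**, `⟨k, α⟩ ↦ shear k ∘ θ_α` — a homomorphism for the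
semidirect product law `(k, α)(k', α') = (k·α k', αα')` (the image of `G_K` in `Aut T(E_q)` is of this
upper-triangular shape: cyclotomic character on `Ẑ(1)·b`, Kummer cocycle of `q` in the corner).
[cite: MochizukiEtTh2009, §1 p.13] -/
def affTwist : (ZH ⋊[MonoidHom.id (MulAut ZH)] MulAut ZH) →* MulAut F₂hatT where
  toFun g := shearHom g.left * twistHom g.right
  map_one' := by
    rw [SemidirectProduct.one_left, SemidirectProduct.one_right, map_one, map_one, mul_one]
  map_mul' g g' := by
    refine MulEquiv.ext fun x => ?_
    rw [SemidirectProduct.mul_left, SemidirectProduct.mul_right, MonoidHom.id_apply, map_mul, map_mul]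
    change shear g.left (shear (g.right g'.left) (twist g.right (twist g'.right x))) =
      shear g.left (twist g.right (shear g'.left (twist g'.right x)))
    rw [twist_shear]

/-- `affTwist ⟨k, α⟩ x = shear k (θ_α x)`. [cite: MochizukiEtTh2009, §1 p.13] -/
theorem affTwist_apply (g : ZH ⋊[MonoidHom.id (MulAut ZH)] MulAut ZH) (x : F₂hatT) :
    affTwist g x = shear g.left (twist g.right x) := rfl

/-- The pure twist inside the affine action: `affTwist (inr α) = θ_α`. [cite: MochizukiEtTh2009, §1 p.13] -/
theorem affTwist_inr (α : MulAut ZH) (x : F₂hatT) : affTwist (SemidirectProduct.inr α) x = twist α x := by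
  rw [affTwist_apply, SemidirectProduct.left_inr, SemidirectProduct.right_inr, shear_one]

/-- Each `affTwist g` is continuous. [cite: MochizukiEtTh2009, §1 p.13] -/
theorem continuous_affTwist (g : ZH ⋊[MonoidHom.id (MulAut ZH)] MulAut ZH) :
    Continuous (affTwist g : F₂hatT → F₂hatT) :=
  (shear g.left).continuous.comp (twist g.right).continuous

/-! ### The shear fixes `ê` and preserves `Γ = F̂₂ ×_Ẑ ℤ` -/

/-- `ê ∘ shear k = ê`. [cite: MochizukiEtTh2009, §1 p.13] -/
theorem eHat_shearEnd (k : ZH) (x : F₂hatT) : eHat (shearEnd k x) = eHat x := by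
  have h : eHat.comp (shearEnd k) = eHat := ext_of_eta
    (by
      change eHat (shearEnd k (eta (FreeGroup.of 0))) = _
      rw [shearEnd_eta_of_zero, map_mul, eHat_bPow, mul_one])
    (by change eHat (shearEnd k (eta (FreeGroup.of 1))) = _; rw [shearEnd_eta_of_one])
  exact DFunLike.congr_fun h x

/-- **`ê (shear k x) = ê x`**. [cite: MochizukiEtTh2009, §1 p.13] -/
theorem eHat_shear (k : ZH) (x : F₂hatT) : eHat (shear k x) = eHat x := eHat_shearEnd k x

/-- `ê (affTwist g x) = ê x` (F4's hypothesis `hΦe` for the affine action). [cite: MochizukiEtTh2009, §1 p.13] -/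
theorem eHat_affTwist (g : ZH ⋊[MonoidHom.id (MulAut ZH)] MulAut ZH) (x : F₂hatT) :
    eHat (affTwist g x) = eHat x := by
  rw [affTwist_apply, eHat_shear, eHat_twist]

/-- The affine action preserves membership in `Γ = F̂₂ ×_Ẑ ℤ`. [cite: MochizukiEtTh2009, §1 p.13] -/
theorem affTwist_mem_Gfp (g : ZH ⋊[MonoidHom.id (MulAut ZH)] MulAut ZH) {q : F₂hatT × Multiplicative ℤ}
    (hq : q ∈ Gfp) : (affTwist g q.1, q.2) ∈ Gfp := by
  rw [mem_Gfp] at hq ⊢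
  change eHat (affTwist g q.1) = iotaZ q.2
  rw [eHat_affTwist]
  exact hq

/-- `affTwist g × id` restricted to `Γ`, as a group automorphism. [cite: MochizukiEtTh2009, §1 p.13] -/
def affTwistGfpEquiv (g : ZH ⋊[MonoidHom.id (MulAut ZH)] MulAut ZH) : Gfp ≃* Gfp where
  toFun q := ⟨(affTwist g (q : F₂hatT × Multiplicative ℤ).1, (q : F₂hatT × Multiplicative ℤ).2),
    affTwist_mem_Gfp g q.2⟩
  invFun q := ⟨(affTwist g⁻¹ (q : F₂hatT × Multiplicative ℤ).1, (q : F₂hatT × Multiplicative ℤ).2),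
    affTwist_mem_Gfp g⁻¹ q.2⟩
  left_inv q := Subtype.ext (Prod.ext (by
    change affTwist g⁻¹ (affTwist g _) = _
    rw [← MulAut.mul_apply, ← map_mul, inv_mul_cancel, map_one, MulAut.one_apply]) rfl)
  right_inv q := Subtype.ext (Prod.ext (by
    change affTwist g (affTwist g⁻¹ _) = _
    rw [← MulAut.mul_apply, ← map_mul, mul_inv_cancel, map_one, MulAut.one_apply]) rfl)
  map_mul' q q' := Subtype.ext (Prod.ext (map_mul (affTwist g) _ _) rfl)

/-- **The affine action on `Γ`**: `affTwistGfp : Ẑ ⋊ Ẑ^× →* Aut(Γ)`, `g ↦ (affTwist g × id)|_Γ` (the action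
through which STAGE 2's `Γ ⋊ G_{ℚ_p}` is formed; `affTwistGfp (inr α) = twistGfp α` on elements).
[cite: MochizukiEtTh2009, §1 p.13] -/
def affTwistGfp : (ZH ⋊[MonoidHom.id (MulAut ZH)] MulAut ZH) →* MulAut Gfp where
  toFun := affTwistGfpEquiv
  map_one' := MulEquiv.ext fun _ => Subtype.ext (Prod.ext (by
    change affTwist 1 _ = _; rw [map_one, MulAut.one_apply]; rfl) rfl)
  map_mul' g g' := MulEquiv.ext fun _ => Subtype.ext (Prod.ext (by
    change affTwist (g * g') _ = affTwist g (affTwist g' _); rw [map_mul, MulAut.mul_apply]) rfl)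

/-- `pr₁ ∘ affTwistGfp g = affTwist g ∘ pr₁`. [cite: MochizukiEtTh2009, §1 p.13] -/
theorem gfpFst_affTwistGfp (g : ZH ⋊[MonoidHom.id (MulAut ZH)] MulAut ZH) (q : Gfp) :
    gfpFst (affTwistGfp g q) = affTwist g (gfpFst q) := rfl

/-- `pr₂ ∘ affTwistGfp g = pr₂`: the affine action fixes the degree `Γ ↠ ℤ`. [cite: MochizukiEtTh2009, §1 p.13] -/
theorem gfpSnd_affTwistGfp (g : ZH ⋊[MonoidHom.id (MulAut ZH)] MulAut ZH) (q : Gfp) :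
    gfpSnd (affTwistGfp g q) = gfpSnd q := rfl

/-- `affTwistGfp (inr α)` is abc-iut-w5-d024's `twistGfp α` (on elements). [cite: MochizukiEtTh2009, §1 p.13] -/
theorem affTwistGfp_inr (α : MulAut ZH) (q : Gfp) : affTwistGfp (SemidirectProduct.inr α) q = twistGfp α q :=
  Subtype.ext (Prod.ext (affTwist_inr α _) rfl)

/-- Each `affTwistGfp g` is continuous. [cite: MochizukiEtTh2009, §1 p.13] -/
theorem continuous_affTwistGfp (g : ZH ⋊[MonoidHom.id (MulAut ZH)] MulAut ZH) :
    Continuous (affTwistGfp g : Gfp → Gfp) := by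
  refine Continuous.subtype_mk ?_ _
  exact ((continuous_affTwist g).comp (continuous_fst.comp continuous_subtype_val)).prodMk
    (continuous_snd.comp continuous_subtype_val)

/-! ### The shear on the Heisenberg levels -/

/-- **A shear by a multiple of `N` is level-`N`-trivial**: `ZHatLevel.level N k = 1 → ĥ_N ∘ shear k = ĥ_N`
(on `η a` the shear contributes `ĥ_N(b^k) = (0, k mod N, 0) = 1`). [cite: MochizukiEtTh2009, §1 p.13] -/
theorem hHat_shear_of_level_eq_one (N : ℕ+) {k : ZH} (hk : ZHatLevel.level N k = 1) (x : F₂hatT) :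
    hHat N (shear k x) = hHat N x := by
  have h : (hHat N).comp (shearEnd k) = hHat N := by
    refine ext_of_eta ?_ ?_
    · change hHat N (shearEnd k (eta (FreeGroup.of 0))) = _
      rw [shearEnd_eta_of_zero, map_mul, hHat_bPow, hk, toAdd_one]
      change hHat N (eta (FreeGroup.of 0)) * (1 : Heis (ZMod N)) = _
      rw [mul_one]
    · change hHat N (shearEnd k (eta (FreeGroup.of 1))) = _
      rw [shearEnd_eta_of_one]
  exact DFunLike.congr_fun h x

/-- The RATIONAL Heisenberg shear `(x, y, z) ↦ (x, y + Kx, z + K(x² + x)/2)` — a group homomorphism of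
`Heis ℚ` (the discrete shadow of `a ↦ a·b^K`; over `ℤ/N`, `N` even, no such homomorphism exists).
[cite: MochizukiEtTh2009, §1 p.13] -/
def Heis.shearQ (K : ℚ) : Heis ℚ →* Heis ℚ where
  toFun h := ⟨h.x, h.y + K * h.x, h.z + K * ((h.x * h.x + h.x) / 2)⟩
  map_one' := by ext <;> simp
  map_mul' a b := by ext <;> simp <;> ring

/-- [cite: MochizukiEtTh2009, §1 p.13] -/
@[simp] theorem Heis.shearQ_apply (K : ℚ) (h : Heis ℚ) :
    Heis.shearQ K h = ⟨h.x, h.y + K * h.x, h.z + K * ((h.x * h.x + h.x) / 2)⟩ := rfl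

/-- `Heis.map (ℤ → ℚ)` is injective. [cite: MochizukiEtTh2009, §1 p.13] -/
theorem Heis.map_intCast_injective : Function.Injective (Heis.map (Int.castRingHom ℚ)) := by
  intro a b h
  simp only [Heis.map_apply, Heis.ext_iff, eq_intCast, Int.cast_inj] at h
  exact Heis.ext h.1 h.2.1 h.2.2

/-- The discrete shear `F₂ → Heis ℤ`, `a ↦ (1, K, K)`, `b ↦ (0, 1, 0)` (the image of `a·b^K`, `b`), read in
`Heis ℚ`, is the rational shear of `heisHom`. [cite: MochizukiEtTh2009, §1 p.13] -/
theorem map_lift_shear_eq_shearQ (K : ℤ) (g : F₂) :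
    Heis.map (Int.castRingHom ℚ) (FreeGroup.lift ![(⟨1, K, K⟩ : Heis ℤ), ⟨0, 1, 0⟩] g) =
      Heis.shearQ (K : ℚ) (Heis.map (Int.castRingHom ℚ) (heisHom g)) := by
  have h : (Heis.map (Int.castRingHom ℚ)).comp (FreeGroup.lift ![(⟨1, K, K⟩ : Heis ℤ), ⟨0, 1, 0⟩]) =
      ((Heis.shearQ (K : ℚ)).comp (Heis.map (Int.castRingHom ℚ))).comp heisHom := by
    refine FreeGroup.ext_hom _ _ fun i => ?_
    fin_cases i
    · simp only [MonoidHom.coe_comp, Function.comp_apply, FreeGroup.lift_apply_of]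
      ext <;> simp
    · simp only [MonoidHom.coe_comp, Function.comp_apply, FreeGroup.lift_apply_of]
      ext <;> simp
  exact DFunLike.congr_fun h g

/-- On words of `a`-exponent sum `0` the discrete shear is trivial: `a·b^K`-substitution does not change
the Heisenberg image of `g` when `(heisHom g).x = 0`. [cite: MochizukiEtTh2009, §1 p.13] -/
theorem lift_shear_eq_heisHom_of_x_eq_zero (K : ℤ) {g : F₂} (hg : (heisHom g).x = 0) :
    FreeGroup.lift ![(⟨1, K, K⟩ : Heis ℤ), ⟨0, 1, 0⟩] g = heisHom g := by
  refine Heis.map_intCast_injective ?_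
  rw [map_lift_shear_eq_shearQ]
  ext <;> simp [hg]

/-- `ĥ_N ∘ shear k ∘ η` is the discrete shear with `K` an integer lift of `k mod N`.
[cite: MochizukiEtTh2009, §1 p.13] -/
theorem hHat_shear_eta (N : ℕ+) (k : ZH) (g : F₂) :
    hHat N (shear k (eta g)) = Heis.map (Int.castRingHom (ZMod N))
      (FreeGroup.lift ![(⟨1, ((Multiplicative.toAdd (ZHatLevel.level N k)).val : ℤ),
        ((Multiplicative.toAdd (ZHatLevel.level N k)).val : ℤ)⟩ : Heis ℤ), ⟨0, 1, 0⟩] g) := by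
  haveI : NeZero (N : ℕ) := ⟨N.ne_zero⟩
  set K : ℤ := ((Multiplicative.toAdd (ZHatLevel.level N k)).val : ℤ) with hK
  have hKN : ((K : ℤ) : ZMod N) = Multiplicative.toAdd (ZHatLevel.level N k) := by
    rw [hK, Int.cast_natCast, ZMod.natCast_zmod_val]
  have h : (hHat N).toMonoidHom.comp ((shearEnd k).toMonoidHom.comp eta) =
      (Heis.map (Int.castRingHom (ZMod N))).comp (FreeGroup.lift ![(⟨1, K, K⟩ : Heis ℤ), ⟨0, 1, 0⟩]) := by
    refine FreeGroup.ext_hom _ _ fun i => ?_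
    fin_cases i
    · change hHat N (shearEnd k (eta (FreeGroup.of 0))) = _
      rw [shearEnd_eta_of_zero, map_mul, hHat_bPow, hHat_eta, heisHom_of_zero]
      simp only [MonoidHom.coe_comp, Function.comp_apply, FreeGroup.lift_apply_of]
      ext <;> simp [hKN]
    · change hHat N (shearEnd k (eta (FreeGroup.of 1))) = _
      rw [shearEnd_eta_of_one, hHat_eta, heisHom_of_one]
      simp only [MonoidHom.coe_comp, Function.comp_apply, FreeGroup.lift_apply_of]
      ext <;> simp
  exact DFunLike.congr_fun h g

/-- Hence on `η(Ker expA)` every shear is level-trivial. [cite: MochizukiEtTh2009, §1 p.13] -/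
theorem hHat_shear_eta_of_expA_eq_one (N : ℕ+) (k : ZH) {g : F₂} (hg : expA g = 1) :
    hHat N (shear k (eta g)) = hHat N (eta g) := by
  have hx : (heisHom g).x = 0 := by
    have := hg; rw [expA_apply] at this; exact ofAdd_eq_one.mp this
  rw [hHat_shear_eta, lift_shear_eq_heisHom_of_x_eq_zero _ hx, hHat_eta]

/-- `ι` separates finite-index subgroups of `ℤ`. [folklore] -/
private theorem hZsep' : ∀ A : Subgroup (Multiplicative ℤ), A.FiniteIndex →
    ∀ k : Multiplicative ℤ, iotaZ k ∈ closure (iotaZ '' (A : Set (Multiplicative ℤ))) → k ∈ A :=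
  fun A hA k hk => by haveI := hA; exact mem_of_toCompletion_mem_closure A k hk

/-- **On `Ker ê = Δ̂_Y` every shear is level-trivial**: `ê x = 1 → ĥ_N (shear k x) = ĥ_N x` — by fibrewise
density of `η(Ker expA)` in `Ker ê` (abc-iut-w5-d218's `TemperedFibreProduct.exists_inv_mul_eta_mem_and_apply_eq`)
applied to the open normal kernel of `y ↦ (ĥ_N (shear k y), ĥ_N y)`. This is what keeps the coverings
`Y_N`, `Z_N` (cut out inside `Ker ê` by level conditions) STABLE under the Tate shear.
[cite: MochizukiEtTh2009, §1 p.13] -/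
theorem hHat_shear_of_eHat_eq_one (N : ℕ+) (k : ZH) {x : F₂hatT} (hx : eHat x = 1) :
    hHat N (shear k x) = hHat N x := by
  -- the open normal kernel of `D : y ↦ (ĥ_N (shear k y), ĥ_N y)`
  let D : F₂hatT →* Heis (ZMod N) × Heis (ZMod N) :=
    ((hHat N).toMonoidHom.comp (shearEnd k).toMonoidHom).prod (hHat N).toMonoidHom
  have hDc : Continuous D :=
    ((hHat N).continuous.comp (shearEnd k).continuous).prodMk (hHat N).continuous
  let V : OpenNormalSubgroup F₂hatT :=
    { toSubgroup := D.ker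
      isOpen' := by
        change IsOpen ((D : F₂hatT → Heis (ZMod N) × Heis (ZMod N)) ⁻¹' {1})
        exact (isOpen_discrete _).preimage hDc
      isNormal' := inferInstance }
  obtain ⟨g, hgV, hg⟩ := TemperedFibreProduct.exists_inv_mul_eta_mem_and_apply_eq eHat iotaZ eta
    denseRange_eta expA expA_surjective eHat_eta hZsep' V x 1 (by rw [hx, map_one])
  have hD : D x = D (eta g) := by
    have h1 : D (x⁻¹ * eta g) = 1 := hgV
    rwa [map_mul, map_inv, inv_mul_eq_one] at h1
  have h₁ : hHat N (shear k x) = hHat N (shear k (eta g)) := congrArg Prod.fst hD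
  have h₂ : hHat N x = hHat N (eta g) := congrArg Prod.snd hD
  rw [h₁, h₂, hHat_shear_eta_of_expA_eq_one N k hg]

/-- **Level-wise triviality of the affine action** (F4's hypothesis `hloc` at STAGE 2, shape): if
`k ∈ N·Ẑ` and `χ_N(α) = 1` then `ĥ_N (affTwist ⟨k, α⟩ x) = ĥ_N x`. [cite: MochizukiEtTh2009, §1 p.13] -/
theorem hHat_affTwist_of_level (N : ℕ+) {k : ZH} {α : MulAut ZH} (hk : ZHatLevel.level N k = 1)
    (hα : ZHatLevel.levelChar N α = 1) (x : F₂hatT) :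
    hHat N (affTwist ⟨k, α⟩ x) = hHat N x := by
  rw [affTwist_apply, hHat_shear_of_level_eq_one N hk, hHat_twist, hα]
  ext <;> simp

/-- On `Γ`, for `q` of degree `0` (`pr₂ q = 1`, i.e. `ê (pr₁ q) = 1`) the SHEAR part of the affine action is
level-trivial: `ĥ_N (pr₁ (affTwistGfp ⟨k, α⟩ q)) = diagTwist (χ_N α) (ĥ_N (pr₁ q))` — so on `Δ̂_Y`-level data
STAGE 2 behaves exactly like abc-iut-w5-d024's diagonal twist. [cite: MochizukiEtTh2009, §1 p.13] -/
theorem hHat_gfpFst_affTwistGfp_of_gfpSnd_eq_one (N : ℕ+) (k : ZH) (α : MulAut ZH) {q : Gfp}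
    (hq : gfpSnd q = 1) :
    hHat N (gfpFst (affTwistGfp ⟨k, α⟩ q)) = Heis.diagTwist (ZHatLevel.levelChar N α) (hHat N (gfpFst q)) := by
  rw [gfpFst_affTwistGfp, affTwist_apply, hHat_shear_of_eHat_eq_one N k, hHat_twist]
  have h := (mem_Gfp _).mp q.2
  rw [gfpSnd_apply] at hq
  rw [eHat_twist, gfpFst_apply, h, hq, map_one]

end Literature.AnabelianGeometry.EtaleTheta.SettingModel

end
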